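import Mathlib
import HarnessLib

/-!
# Witt's lemma: normalizers of Sylow subgroups of stabilizers act transitively on fixed points

Topic `Literature/GroupTheory/PermutationGroups`.  Fully PROVED folklore ("Witt's lemma", the
Frattini argument for permutation groups; stated e.g. as Proposition 1.1 of C. E. Praeger's 1973
Oxford thesis *On the Sylow subgroups of primitive permutation groups*, in the more general form
with a weakly closed subgroup of the Sylow subgroup), used throughout the Sylow analysis of
permutation groups (Praeger's fixed-point theorems, Jordan's `p`-cycle theorem, Praeger–Saxl 1980):

* `Witt.exists_mem_normalizer_smul_eq` — if `G` acts transitively on `β`, `P ≤ G_a` has the order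
  of a Sylow `p`-subgroup of the stabilizer `G_a`, and `P` also fixes `b`, then some element of the
  normalizer `N_G(P)` maps `a` to `b`.  (So `N_G(P)` is transitive on the fixed points of `P`.)
* `Witt.exists_mem_normalizer_smul_embedding_eq` — the `k`-fold version: for a `k`-transitive action
  and `P` of Sylow order in the pointwise stabilizer of a `k`-tuple of fixed points, `N_G(P)` is
  `k`-transitive on the fixed points of `P` (apply the first statement to the action on `k`-tuples).
-/

namespace Literature.GroupTheory.PermutationGroups

open MulAction Subgroup
open scoped Pointwise

namespace Witt

variable {G : Type*} [Group G] [Finite G] {β : Type*} [MulAction G β]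

/-- **Witt's lemma.** Let `G` act transitively on `β`, let `a b : β`, and let `P ≤ G_a` be a subgroup
whose order is that of a Sylow `p`-subgroup of the stabilizer `G_a`.  If `P ≤ G_b` as well, then
there is `g ∈ N_G(P)` with `g • a = b`. [folklore] -/
theorem exists_mem_normalizer_smul_eq [IsPretransitive G β] {p : ℕ} [hp : Fact p.Prime] (a b : β)
    (P : Subgroup G) (hPa : P ≤ stabilizer G a)
    (hcard : Nat.card P = p ^ (Nat.card (stabilizer G a)).factorization p)
    (hPb : P ≤ stabilizer G b) :
    ∃ g ∈ normalizer (P : Set G), g • a = b := by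
  classical
  set S := stabilizer G a with hS
  obtain ⟨g₀, hg₀⟩ := exists_smul_eq G a b
  -- `P' = g₀⁻¹ P g₀` lies in `S = G_a` because `P ≤ G_b = g₀ G_a g₀⁻¹`
  set P' : Subgroup G := P.map (MulAut.conj g₀⁻¹).toMonoidHom with hP'
  have hmemP' : ∀ y, y ∈ P' ↔ g₀ * y * g₀⁻¹ ∈ P := by
    intro y
    constructor
    · rintro ⟨x, hx, rfl⟩
      simpa [MulAut.conj_apply, mul_assoc] using hx
    · intro hy
      refine ⟨g₀ * y * g₀⁻¹, hy, ?_⟩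
      simp [mul_assoc]
  have hP'S : P' ≤ S := by
    intro y hy
    rw [hmemP'] at hy
    have hyb : g₀ * y * g₀⁻¹ ∈ stabilizer G b := hPb hy
    rw [← hg₀, stabilizer_smul_eq_stabilizer_map_conj] at hyb
    obtain ⟨z, hz, hzy⟩ := hyb
    have : y = z := by
      have := hzy
      simp only [MulEquiv.coe_toMonoidHom, MulAut.conj_apply] at this
      -- g₀ * z * g₀⁻¹ = g₀ * y * g₀⁻¹
      have h1 := congrArg (fun w => g₀⁻¹ * w * g₀) this
      simpa [mul_assoc] using h1.symm
    rw [this]; exact hz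
  -- cardinalities
  have hcardP' : Nat.card P' = Nat.card P :=
    Subgroup.card_map_of_injective (MulAut.conj g₀⁻¹).injective
  have hcard1 : Nat.card (P.subgroupOf S) = p ^ (Nat.card S).factorization p := by
    rw [Nat.card_congr (Subgroup.subgroupOfEquivOfLe hPa).toEquiv, hcard]
  have hcard2 : Nat.card (P'.subgroupOf S) = p ^ (Nat.card S).factorization p := by
    rw [Nat.card_congr (Subgroup.subgroupOfEquivOfLe hP'S).toEquiv, hcardP', hcard]
  set SP : Sylow p S := Sylow.ofCard (P.subgroupOf S) hcard1 with hSP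
  set SQ : Sylow p S := Sylow.ofCard (P'.subgroupOf S) hcard2 with hSQ
  haveI : IsPretransitive S (Sylow p S) := Sylow.isPretransitive_of_finite
  obtain ⟨s, hs⟩ := exists_smul_eq S SQ SP
  -- unpack the conjugacy: for `y ∈ S`, `y ∈ P ↔ s⁻¹ y s ∈ P'`
  have hconj : ∀ x ∈ P, (g₀ * (s : G)⁻¹) * x * (g₀ * (s : G)⁻¹)⁻¹ ∈ P := by
    intro x hx
    set y : S := ⟨x, hPa hx⟩ with hy
    have hySP : y ∈ (SP : Subgroup S) := by
      change y ∈ P.subgroupOf S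
      rw [mem_subgroupOf]; exact hx
    rw [← hs, Sylow.coe_subgroup_smul, Subgroup.mem_pointwise_smul_iff_inv_smul_mem] at hySP
    change (MulAut.conj s)⁻¹ y ∈ P'.subgroupOf S at hySP
    rw [mem_subgroupOf, MulAut.conj_inv_apply] at hySP
    have : ((s⁻¹ * y * s : S) : G) ∈ P' := hySP
    rw [hmemP'] at this
    simpa [mul_assoc, mul_inv_rev] using this
  -- hence `n = g₀ s⁻¹` normalizes `P`
  set n : G := g₀ * (s : G)⁻¹ with hn
  have hmap : P.map (MulAut.conj n).toMonoidHom = P := by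
    apply Subgroup.eq_of_le_of_card_ge
    · rintro _ ⟨x, hx, rfl⟩
      simpa [MulAut.conj_apply] using hconj x hx
    · rw [Subgroup.card_map_of_injective (MulAut.conj n).injective]
  refine ⟨n, ?_, ?_⟩
  · rw [mem_normalizer_iff]
    intro h
    constructor
    · intro hh
      have : (MulAut.conj n).toMonoidHom h ∈ P.map (MulAut.conj n).toMonoidHom :=
        Subgroup.mem_map_of_mem _ hh
      rw [hmap] at this
      simpa [MulAut.conj_apply] using this
    · intro hh
      rw [← hmap] at hh
      obtain ⟨x, hx, hxe⟩ := hh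
      have : x = h := by
        simpa [MulAut.conj_apply] using hxe
      rw [← this]; exact hx
  · have hsa : (s : G)⁻¹ • a = a := by
      have : ((s⁻¹ : S) : G) • a = a := (s⁻¹).2
      simpa using this
    rw [hn, mul_smul, hsa, hg₀]

omit [Finite G] in
/-- The stabilizer of a `k`-tuple (embedding) contains `P` iff `P` fixes every entry. [folklore] -/
theorem le_stabilizer_embedding_iff {k : ℕ} (x : Fin k ↪ β) (P : Subgroup G) :
    P ≤ stabilizer G x ↔ ∀ i, P ≤ stabilizer G (x i) := by
  constructor
  · intro h i g hg
    have := h hg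
    rw [mem_stabilizer_iff] at this ⊢
    have := congrArg (fun e : Fin k ↪ β => e i) this
    simpa using this
  · intro h g hg
    rw [mem_stabilizer_iff]
    ext i
    have := h i hg
    rw [mem_stabilizer_iff] at this
    simpa using this

/-- **Witt's lemma, `k`-fold form.** If `G` is `k`-transitive on `β`, `x y` are `k`-tuples of
distinct points, `P` fixes all entries of `x` and of `y`, and `|P|` is the order of a Sylow
`p`-subgroup of the pointwise stabilizer of `x`, then some `g ∈ N_G(P)` maps `x` to `y`; i.e.
`N_G(P)` acts `k`-transitively on the fixed points of `P`. [folklore] -/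
theorem exists_mem_normalizer_smul_embedding_eq {k : ℕ} [IsMultiplyPretransitive G β k]
    {p : ℕ} [Fact p.Prime] (x y : Fin k ↪ β) (P : Subgroup G)
    (hPx : ∀ i, P ≤ stabilizer G (x i))
    (hcard : Nat.card P = p ^ (Nat.card (stabilizer G x)).factorization p)
    (hPy : ∀ i, P ≤ stabilizer G (y i)) :
    ∃ g ∈ normalizer (P : Set G), g • x = y :=
  exists_mem_normalizer_smul_eq (β := Fin k ↪ β) x y P
    ((le_stabilizer_embedding_iff x P).mpr hPx) hcard ((le_stabilizer_embedding_iff y P).mpr hPy)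

end Witt

end Literature.GroupTheory.PermutationGroups
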